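import Summits.AtomisticToContinuum.Crystallization.Theorems.FrustratedLawDichotomyStrainedPatchQuantSlavingA

/-!
# «QuantSlaving» part B (§2 tables / enclosures / seams, §3 the bridge, §4 records, §5 class threshold) — sequel of `…StrainedPatchQuantSlavingA`

decomp-a2c lens-5 g57 node «QuantSlavingIFT» (crux `AperiodicFrustratedLawGap`, stmt-AtomisticToContinuum-27623, 27623 T-side [CORE-FAR]; critic rows 1059/1066 VERIFIED 79/79 STD).
Split for the 400-line cap by the landing lane (hand-2 g29); the module docstring of part A describes the whole node.  Same namespace; all FQNs unchanged.
0 sorry; standard axioms; no instances / notation / `#eval`.  `--supports stmt-AtomisticToContinuum-27623`.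
-/

namespace Summit.AtomisticToContinuum.Crystallization.Theorems.FrustratedLawDichotomyStrainedPatchQuantSlaving


open scoped BigOperators Classical
open Literature.MathematicalPhysics.StatisticalMechanics (lennardJones)
open Summit.AtomisticToContinuum.Crystallization.Theorems.FrustratedLawDichotomyPeriodicBlockFlags (goodAtScale_mono)
open Summit.AtomisticToContinuum.Crystallization.Theorems.FrustratedLawDichotomyRangeCut (Sep)
open Summit.AtomisticToContinuum.Crystallization.Theorems.FrustratedLawDichotomyMotifLemmas
open Summit.AtomisticToContinuum.Crystallization.Theorems.FrustratedLawDichotomyAveragingCut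
open Summit.AtomisticToContinuum.Crystallization.Theorems.FrustratedLawDichotomyAveragingRuleCap
open Summit.AtomisticToContinuum.Crystallization.Theorems.FrustratedLawDichotomyAveragingRuleTightFree
open Summit.AtomisticToContinuum.Crystallization.Theorems.FrustratedLawDichotomyStrainedPatchHomSplit
open Summit.AtomisticToContinuum.Crystallization.Theorems.FrustratedLawDichotomyStrainedPatchCleanCollar
open Summit.AtomisticToContinuum.Crystallization.Theorems.FrustratedLawDichotomyStrainedPatchHomIsometry
open Summit.AtomisticToContinuum.Crystallization.Theorems.FrustratedLawDichotomyStrainedPatchHomTubeIso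
open Summit.AtomisticToContinuum.Crystallization.Theorems.FrustratedLawDichotomyStrainedPatchPhaseCut
open Summit.AtomisticToContinuum.Crystallization.Theorems.FrustratedLawDichotomyStrainedPatchCoreTube
open Summit.AtomisticToContinuum.Crystallization.Theorems.FrustratedLawDichotomyStrainedPatchCoreTubeRecord
open Summit.AtomisticToContinuum.Crystallization.Theorems.FrustratedLawDichotomyStrainedPatchStrainBands
open Summit.AtomisticToContinuum.Crystallization.Theorems.FrustratedLawDichotomyStrainedPatchChartFamilies
open Summit.AtomisticToContinuum.Crystallization.Theorems.FrustratedLawDichotomyStrainedPatchChartFamiliesBent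
open Summit.AtomisticToContinuum.Crystallization.Theorems.FrustratedLawDichotomyStrainedPatchChartFamiliesPinned
open Summit.AtomisticToContinuum.Crystallization.Theorems.FrustratedLawDichotomyStrainedPatchEnvelopeLaw
open Summit.AtomisticToContinuum.Crystallization.Theorems.FrustratedLawDichotomyStrainedPatchEnvelopeTaylor
open Summit.AtomisticToContinuum.Crystallization.Theorems.FrustratedLawDichotomyStrainedPatchWindowFamilies
open Summit.AtomisticToContinuum.Crystallization.Theorems.FrustratedLawDichotomyStrainedPatchRecutPairs
open Summit.AtomisticToContinuum.Crystallization.Theorems.FrustratedLawDichotomyStrainedPatchMembership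
open Summit.AtomisticToContinuum.Crystallization.Theorems.FrustratedLawDichotomyStrainedPatchDirect
open Summit.AtomisticToContinuum.Crystallization.Theorems.FrustratedLawDichotomyStrainedPatchTaylorPairSigned
open Summit.AtomisticToContinuum.Crystallization.Theorems.FrustratedLawDichotomyStrainedPatchTaylorKbandMinus
open Summit.AtomisticToContinuum.Crystallization.Theorems.FrustratedLawDichotomyStrainedPatchTaylorKbandMinusD

/-! ## §2. The linear force model as TABLES, the inflated polytope, (ENC) / (NEEDCERT) / (BASCERT) and the seams -/

/-- The LJ PAIR HESSIAN `∇²_x V(‖x‖) = ((V''(r) − V'(r)/r)/r²)·x xᵀ + (V'(r)/r)·1` (`r = ‖x‖ ≠ 0`) as a continuous linear map. -/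
noncomputable def pairHess (x : E3) : E3 →L[ℝ] E3 :=
  ((ljD2 ‖x‖ - ljD1 ‖x‖ / ‖x‖) / ‖x‖ ^ 2) • (innerSL ℝ x).smulRight x + (ljD1 ‖x‖ / ‖x‖) • ContinuousLinearMap.id ℝ E3

/-- ★ The designated TRUE HESSIAN BLOCK TABLE of the move-test forces at an instance: `H₀(z₀)(b, b') = ∂F_b/∂y_{b'}` — diagonal `−Σ_{k ∈ moveNbrs} ∇²V(z₀ b − z₀ k)`,
off-diagonal `+∇²V(z₀ b − z₀ b')` for move neighbours, `0` otherwise (centre argument unused). -/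
noncomputable def hessBlk0 : HessTab := fun _ z₀ _ b b' =>
  if b' = b then -∑ k ∈ moveNbrs 7 z₀ b, pairHess (z₀ b - z₀ k) else if b' ∈ moveNbrs 7 z₀ b then pairHess (z₀ b - z₀ b') else 0

/-- ★ The designated TRUE FORCE TABLE at an instance: `F₀(z₀)(b) = siteForce 7 z₀ b`. -/
noncomputable def force0 : ForceTab := fun _ z₀ _ b => siteForce 7 z₀ b

/-- The LINEARISED FORCE at a charted ball site `a` through tables `(H, F)` read at the instance: `F(z₀)(e a) + Σ_{a' ∈ B(c, 63/10)} H(z₀)(e a, e a')(dev a')`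
(centres superposed, so the true displacement of `a` relative to `e a` is `dev a`). -/
noncomputable def linForce (H : HessTab) (F : ForceTab) {M : ℕ} (z : Fin M → E3) (c : Fin M) {M₀ : ℕ} (z₀ : Fin M₀ → E3) (c₀ : Fin M₀)
    (e : Fin M → Fin M₀) (a : Fin M) : E3 :=
  F M₀ z₀ c₀ (e a) + ∑ a' ∈ ball (63 / 10) z c, H M₀ z₀ c₀ (e a) (e a') (dev z c z₀ c₀ e a')

/-- ★ **`InForcePolytope κ σ H F X z c z₀ c₀ e`** — the chart's deviation field satisfies the `κ`-INFLATED LINEAR FORCE ROWS of the instance: at every reach site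
`a` of the ball `‖linForce H F … a‖ ≤ (1 + κ)·σ + X(z₀)(e a)`.  `κ·σ` absorbs the second-order force remainder; the column `X` absorbs the UNMODELLED part of the
true row (exterior beyond the charted ball — the census's g0a —, uncovered partners, cutoff-shell mismatch).  With `H = hessBlk0`, `F = force0` this is the
census's one-move polytope `P(κ)` of OUTER30 (O1)–(O4), read on the cluster; the rim pins are ChartBy's fine clause, not repeated here. -/
def InForcePolytope (κ σ : ℝ) (H : HessTab) (F : ForceTab) (X : SlackTab) {M : ℕ} (z : Fin M → E3) (c : Fin M) {M₀ : ℕ} (z₀ : Fin M₀ → E3)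
    (c₀ : Fin M₀) (e : Fin M → Fin M₀) : Prop :=
  ∀ a ∈ ball (63 / 10) z c, IsReach z c a → ‖linForce H F z c z₀ c₀ e a‖ ≤ (1 + κ) * σ + X M₀ z₀ c₀ (e a)

/-- ★★ **(ENC κ) `SlavingEnclosure 𝓘 τ δ T κ σ H F X`** [ANALYTIC · UNDECIDED — the typed conclusion of «QuantSlavingIFT» (critic row 1051 (B))] — every admissible
clean mono-phase cluster charted (coarse `τ`, roughness `0 ≤ t ≤ T(z₀)`) and `δ`-finely by an instance of `𝓘` has its deviation field IN THE `κ`-INFLATED POLYTOPE.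
Content: on the `δ`-tube the second-order force remainder of every reach row is `≤ κ·σ` — only a STRUCTURED remainder can give a useful `κ` (affine fields have zero
remainder at inversion centres; hcp sites carry the strain–shuffle term; structure-free: `κ ≈ 287` at `δ₀`).  Sufficient conditions: §3. -/
def SlavingEnclosure (𝓘 : ChartFam) (τ δ : ℝ) (T : LawTab) (κ σ : ℝ) (H : HessTab) (F : ForceTab) (X : SlackTab) : Prop :=
  ∀ (M : ℕ) (z : Fin M → E3) (c : Fin M) (M₀ : ℕ) (z₀ : Fin M₀ → E3) (c₀ : Fin M₀) (e : Fin M → Fin M₀) (t : ℝ),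
    Admissible M z c → CleanBall (63 / 10) z c → MonoPhaseBall (63 / 10) z c → 0 ≤ t → t ≤ T M₀ z₀ c₀ → ChartBy 𝓘 τ t z c z₀ c₀ e →
      FineChart δ z c z₀ c₀ e → InForcePolytope κ σ H F X z c z₀ c₀ e

/-- ★★ **(NEEDCERT κ Ψ) `NeedCert 𝓘 τ δ T κ σ H F X G w Ψ`** [INSTRUMENTABLE — one finite LP per instance (census (O1) `M_D^outer(κ)`); Lean-side an LP-dual
certificate] — for every chart by an instance of `𝓘` (coarse `τ`, roughness `0 ≤ t ≤ T(z₀)`, `δ`-fine) whose deviation field lies in `P(κ)`: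
`−Ψ(z₀)(T z₀) ≤ lin_G(dev) − quad_w(dev)`.  NO admissibility, cleanness or phase hypothesis: a statement about the instance's finite-dimensional polytope (coarse /
fine boxes, rim pins, inflated force rows) — the SOUND instance-side LP pins only CERTAINLY-uncapped and rows only CERTAINLY-reach images under the `2δ` set fuzz
(memo §3 g0c); (LIN-law) holds for `Ψ :=` its value whenever (ENC κ) holds. -/
def NeedCert (𝓘 : ChartFam) (τ δ : ℝ) (T : LawTab) (κ σ : ℝ) (H : HessTab) (F : ForceTab) (X : SlackTab) (G : GradTab) (w : WtTab) (Ψ : ModTab) : Prop :=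
  ∀ (M : ℕ) (z : Fin M → E3) (c : Fin M) (M₀ : ℕ) (z₀ : Fin M₀ → E3) (c₀ : Fin M₀) (e : Fin M → Fin M₀) (t : ℝ),
    0 ≤ t → t ≤ T M₀ z₀ c₀ → ChartBy 𝓘 τ t z c z₀ c₀ e → FineChart δ z c z₀ c₀ e → InForcePolytope κ σ H F X z c z₀ c₀ e →
      -Ψ M₀ z₀ c₀ (T M₀ z₀ c₀) ≤ linTerm G z c z₀ c₀ e - quadTerm w z c z₀ c₀ e

/-- ★ **(BASCERT δ₁ κ δ) `BasinCert 𝓘 τ δ₁ T κ σ H F X δ`** [INSTRUMENTABLE in principle — census (O2) `BASIN^outer(κ)`] — a `δ₁`-fine chart in `P(κ)` is `δ`-fine.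
CAVEAT (memo §3 g0c): the instance-side LP must pin only CERTAINLY-uncapped images; under the coarse fuzz `δ₁ = τ = 1/4` there are none (threshold geometry
`63/10 − 9/5 = 9/2` is marginal), so (BASCERT τ κ δ₀) is presumably uncertifiable and the basin is NOT split through it; at `δ₁ ≈ δ₀` it is a genuine TIGHTENING
certificate (about half the rim certainly pinned at the √3-shell hosts). -/
def BasinCert (𝓘 : ChartFam) (τ δ₁ : ℝ) (T : LawTab) (κ σ : ℝ) (H : HessTab) (F : ForceTab) (X : SlackTab) (δ : ℝ) : Prop :=
  ∀ (M : ℕ) (z : Fin M → E3) (c : Fin M) (M₀ : ℕ) (z₀ : Fin M₀ → E3) (c₀ : Fin M₀) (e : Fin M → Fin M₀) (t : ℝ),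
    0 ≤ t → t ≤ T M₀ z₀ c₀ → ChartBy 𝓘 τ t z c z₀ c₀ e → FineChart δ₁ z c z₀ c₀ e → InForcePolytope κ σ H F X z c z₀ c₀ e → FineChart δ z c z₀ c₀ e

/-- ★★ THE (LIN) SEAM: (ENC κ) ∧ (NEEDCERT κ Ψ) ⟹ (LIN-law Ψ) — every family, law, radius and tables. [folklore] -/
theorem slavedLaw_of_enclosure {𝓘 : ChartFam} {τ δ : ℝ} {T : LawTab} {κ σ : ℝ} {H : HessTab} {F : ForceTab} {X : SlackTab} {G : GradTab} {w : WtTab}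
    {Ψ : ModTab} (hE : SlavingEnclosure 𝓘 τ δ T κ σ H F X) (hN : NeedCert 𝓘 τ δ T κ σ H F X G w Ψ) : SlavedLaw 𝓘 τ δ T G w Ψ :=
  fun M z c M₀ z₀ c₀ e t hz hcl hm ht htT hch hf => hN M z c M₀ z₀ c₀ e t ht htT hch hf (hE M z c M₀ z₀ c₀ e t hz hcl hm ht htT hch hf)

/-- The COARSE clause of `ChartBy` IS `FineChart τ`. [formal bookkeeping] -/
theorem fineChart_of_chartBy {𝓘 : ChartFam} {τ t : ℝ} {M : ℕ} {z : Fin M → E3} {c : Fin M} {M₀ : ℕ} {z₀ : Fin M₀ → E3} {c₀ : Fin M₀} {e : Fin M → Fin M₀}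
    (h : ChartBy 𝓘 τ t z c z₀ c₀ e) : FineChart τ z c z₀ c₀ e := fun a ha => by
  rw [dev, ← dist_eq_norm]
  exact h.2.2.1 a ha

/-- Hence (BAS-fix) at the coarse radius is free. [formal bookkeeping] -/
theorem basinFix_coarse (𝓘 : ChartFam) (τ : ℝ) (T : LawTab) : BasinFix 𝓘 τ τ T :=
  fun _ _ _ _ _ _ _ _ _ _ _ _ _ hch => fineChart_of_chartBy hch

/-- ★ THE (BAS) SEAM: (BAS-fix δ₁) ∧ (ENC κ at δ₁) ∧ (BASCERT δ₁ κ δ) ⟹ (BAS-fix δ) — a localisation at radius `δ₁` is TIGHTENED to `δ` by the polytope. [folklore] -/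
theorem basinFix_of_enclosure {𝓘 : ChartFam} {τ δ₁ δ : ℝ} {T : LawTab} {κ σ : ℝ} {H : HessTab} {F : ForceTab} {X : SlackTab} (hL : BasinFix 𝓘 τ δ₁ T)
    (hE : SlavingEnclosure 𝓘 τ δ₁ T κ σ H F X) (hB : BasinCert 𝓘 τ δ₁ T κ σ H F X δ) : BasinFix 𝓘 τ δ T :=
  fun M z c M₀ z₀ c₀ e t hz hcl hm ht htT hch =>
    hB M z c M₀ z₀ c₀ e t ht htT hch (hL M z c M₀ z₀ c₀ e t hz hcl hm ht htT hch)
      (hE M z c M₀ z₀ c₀ e t hz hcl hm ht htT hch (hL M z c M₀ z₀ c₀ e t hz hcl hm ht htT hch))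

/-- (ENC κ at the coarse radius τ) ∧ (BASCERT τ κ δ) ⟹ (BAS-fix δ) — formally; see the caveat on `BasinCert`. [folklore] -/
theorem basinFix_of_enclosure_coarse {𝓘 : ChartFam} {τ δ : ℝ} {T : LawTab} {κ σ : ℝ} {H : HessTab} {F : ForceTab} {X : SlackTab}
    (hE : SlavingEnclosure 𝓘 τ τ T κ σ H F X) (hB : BasinCert 𝓘 τ τ T κ σ H F X δ) : BasinFix 𝓘 τ δ T :=
  basinFix_of_enclosure (basinFix_coarse 𝓘 τ T) hE hB

/-- The polytope GROWS with `κ` (for `σ ≥ 0`). [formal bookkeeping] -/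
theorem inForcePolytope_mono {κ κ' σ : ℝ} (hκ : κ ≤ κ') (hσ : 0 ≤ σ) {H : HessTab} {F : ForceTab} {X : SlackTab} {M : ℕ} {z : Fin M → E3} {c : Fin M}
    {M₀ : ℕ} {z₀ : Fin M₀ → E3} {c₀ : Fin M₀} {e : Fin M → Fin M₀} (h : InForcePolytope κ σ H F X z c z₀ c₀ e) : InForcePolytope κ' σ H F X z c z₀ c₀ e :=
  fun a ha hr => by
    have h₁ := h a ha hr
    have h₂ : (1 + κ) * σ ≤ (1 + κ') * σ := mul_le_mul_of_nonneg_right (by linarith) hσ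
    linarith

/-- (ENC) is MONOTONE in `κ`. [formal bookkeeping] -/
theorem slavingEnclosure_mono_kappa {𝓘 : ChartFam} {τ δ : ℝ} {T : LawTab} {κ κ' σ : ℝ} (hκ : κ ≤ κ') (hσ : 0 ≤ σ) {H : HessTab} {F : ForceTab} {X : SlackTab}
    (h : SlavingEnclosure 𝓘 τ δ T κ σ H F X) : SlavingEnclosure 𝓘 τ δ T κ' σ H F X :=
  fun M z c M₀ z₀ c₀ e t hz hcl hm ht htT hch hf => inForcePolytope_mono hκ hσ (h M z c M₀ z₀ c₀ e t hz hcl hm ht htT hch hf)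

/-- (NEEDCERT) is ANTITONE in `κ`. [formal bookkeeping] -/
theorem needCert_anti_kappa {𝓘 : ChartFam} {τ δ : ℝ} {T : LawTab} {κ κ' σ : ℝ} (hκ : κ' ≤ κ) (hσ : 0 ≤ σ) {H : HessTab} {F : ForceTab} {X : SlackTab}
    {G : GradTab} {w : WtTab} {Ψ : ModTab} (h : NeedCert 𝓘 τ δ T κ σ H F X G w Ψ) : NeedCert 𝓘 τ δ T κ' σ H F X G w Ψ :=
  fun M z c M₀ z₀ c₀ e t ht htT hch hf hP => h M z c M₀ z₀ c₀ e t ht htT hch hf (inForcePolytope_mono hκ hσ hP)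

/-- (BASCERT) is ANTITONE in `κ`. [formal bookkeeping] -/
theorem basinCert_anti_kappa {𝓘 : ChartFam} {τ δ₁ δ : ℝ} {T : LawTab} {κ κ' σ : ℝ} (hκ : κ' ≤ κ) (hσ : 0 ≤ σ) {H : HessTab} {F : ForceTab} {X : SlackTab}
    (h : BasinCert 𝓘 τ δ₁ T κ σ H F X δ) : BasinCert 𝓘 τ δ₁ T κ' σ H F X δ :=
  fun M z c M₀ z₀ c₀ e t ht htT hch hf hP => h M z c M₀ z₀ c₀ e t ht htT hch hf (inForcePolytope_mono hκ hσ hP)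

/-- (ENC) is ANTITONE in the family. [formal bookkeeping] -/
theorem slavingEnclosure_anti {𝓘 𝓘' : ChartFam} (hle : FamilyLE 𝓘 𝓘') {τ δ : ℝ} {T : LawTab} {κ σ : ℝ} {H : HessTab} {F : ForceTab} {X : SlackTab}
    (h : SlavingEnclosure 𝓘' τ δ T κ σ H F X) : SlavingEnclosure 𝓘 τ δ T κ σ H F X :=
  fun M z c M₀ z₀ c₀ e t hz hcl hm ht htT hch hf => h M z c M₀ z₀ c₀ e t hz hcl hm ht htT (hch.mono_family hle) hf

/-- (NEEDCERT) is ANTITONE in the family. [formal bookkeeping] -/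
theorem needCert_anti {𝓘 𝓘' : ChartFam} (hle : FamilyLE 𝓘 𝓘') {τ δ : ℝ} {T : LawTab} {κ σ : ℝ} {H : HessTab} {F : ForceTab} {X : SlackTab} {G : GradTab}
    {w : WtTab} {Ψ : ModTab} (h : NeedCert 𝓘' τ δ T κ σ H F X G w Ψ) : NeedCert 𝓘 τ δ T κ σ H F X G w Ψ :=
  fun M z c M₀ z₀ c₀ e t ht htT hch hf hP => h M z c M₀ z₀ c₀ e t ht htT (hch.mono_family hle) hf hP

/-! ## §3. THE BRIDGE: the finite descending chain of enclosures (finite instrumentable range + analytic regime + monotone glue) -/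

/-- ★ **(STEP κ κ') `RemainderStep 𝓘 τ δ T σ H F X κ κ'`** [ANALYTIC (Taylor identity) + INSTRUMENTABLE (a structured sup bound of the second-order force remainder
over the linear image `P(κ) ∩ tube`) · UNDECIDED per step] — an admissible clean mono-phase `δ`-finely charted cluster in `P(κ)` is in `P(κ')`. -/
def RemainderStep (𝓘 : ChartFam) (τ δ : ℝ) (T : LawTab) (σ : ℝ) (H : HessTab) (F : ForceTab) (X : SlackTab) (κ κ' : ℝ) : Prop :=
  ∀ (M : ℕ) (z : Fin M → E3) (c : Fin M) (M₀ : ℕ) (z₀ : Fin M₀ → E3) (c₀ : Fin M₀) (e : Fin M → Fin M₀) (t : ℝ),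
    Admissible M z c → CleanBall (63 / 10) z c → MonoPhaseBall (63 / 10) z c → 0 ≤ t → t ≤ T M₀ z₀ c₀ → ChartBy 𝓘 τ t z c z₀ c₀ e →
      FineChart δ z c z₀ c₀ e → InForcePolytope κ σ H F X z c z₀ c₀ e → InForcePolytope κ' σ H F X z c z₀ c₀ e

/-- One step. [formal bookkeeping] -/
theorem slavingEnclosure_of_step {𝓘 : ChartFam} {τ δ : ℝ} {T : LawTab} {κ κ' σ : ℝ} {H : HessTab} {F : ForceTab} {X : SlackTab}
    (h : SlavingEnclosure 𝓘 τ δ T κ σ H F X) (hs : RemainderStep 𝓘 τ δ T σ H F X κ κ') : SlavingEnclosure 𝓘 τ δ T κ' σ H F X :=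
  fun M z c M₀ z₀ c₀ e t hz hcl hm ht htT hch hf => hs M z c M₀ z₀ c₀ e t hz hcl hm ht htT hch hf (h M z c M₀ z₀ c₀ e t hz hcl hm ht htT hch hf)

/-- ★★ **THE CHAIN LEMMA** — (ENC `k 0`) and the steps (STEP `k i` `k (i+1)`), `i < n`, give (ENC `k n`): a FINITE RANGE of instrumentable contraction steps bridged by
induction; no convergence, no fixed-point theorem, no metric. [folklore] -/
theorem slavingEnclosure_of_chain {𝓘 : ChartFam} {τ δ : ℝ} {T : LawTab} {σ : ℝ} {H : HessTab} {F : ForceTab} {X : SlackTab} (k : ℕ → ℝ) (n : ℕ)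
    (h0 : SlavingEnclosure 𝓘 τ δ T (k 0) σ H F X) (hs : ∀ i : ℕ, i < n → RemainderStep 𝓘 τ δ T σ H F X (k i) (k (i + 1))) :
    SlavingEnclosure 𝓘 τ δ T (k n) σ H F X := by
  induction n with
  | zero => exact h0
  | succ n ih => exact slavingEnclosure_of_step (ih fun i hi => hs i (Nat.lt_succ_of_lt hi)) (hs n n.lt_succ_self)

/-- ★ **(TFR ρ) `ForceTaylorBound 𝓘 τ δ T ρ H F X`** [KNOWN-MATH · ATTACKABLE (L): multivariate Taylor of the pair force over the `δ`-tube with CRUDE constants, the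
unmodelled part into `X`] — on the `δ`-tube the TRUE move-test force at a reach site differs from its linearisation through the tables by at most `ρ + X(e a)`.
With `H = hessBlk0`, `F = force0`, `δ = δ₀`: `ρ ≈ 287 σ₁` structure-free (census OUTER30-METHOD §3) — the A-PRIORI enclosure. -/
def ForceTaylorBound (𝓘 : ChartFam) (τ δ : ℝ) (T : LawTab) (ρ : ℝ) (H : HessTab) (F : ForceTab) (X : SlackTab) : Prop :=
  ∀ (M : ℕ) (z : Fin M → E3) (c : Fin M) (M₀ : ℕ) (z₀ : Fin M₀ → E3) (c₀ : Fin M₀) (e : Fin M → Fin M₀) (t : ℝ),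
    Admissible M z c → CleanBall (63 / 10) z c → MonoPhaseBall (63 / 10) z c → 0 ≤ t → t ≤ T M₀ z₀ c₀ → ChartBy 𝓘 τ t z c z₀ c₀ e →
      FineChart δ z c z₀ c₀ e → ∀ a ∈ ball (63 / 10) z c, IsReach z c a → ‖siteForce 7 z a - linForce H F z c z₀ c₀ e a‖ ≤ ρ + X M₀ z₀ c₀ (e a)

/-- ★ **(TFR-in κ ρ) `ForceTaylorBoundIn 𝓘 τ δ T κ σ ρ H F X`** [ANALYTIC + INSTRUMENTABLE: the STRUCTURED remainder bound `sup_{P(κ) ∩ tube} ‖R_a‖ ≤ ρ`, census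
`c2s(κ)`] — the same remainder bound using the extra information `dev ∈ P(κ)`. -/
def ForceTaylorBoundIn (𝓘 : ChartFam) (τ δ : ℝ) (T : LawTab) (κ σ ρ : ℝ) (H : HessTab) (F : ForceTab) (X : SlackTab) : Prop :=
  ∀ (M : ℕ) (z : Fin M → E3) (c : Fin M) (M₀ : ℕ) (z₀ : Fin M₀ → E3) (c₀ : Fin M₀) (e : Fin M → Fin M₀) (t : ℝ),
    Admissible M z c → CleanBall (63 / 10) z c → MonoPhaseBall (63 / 10) z c → 0 ≤ t → t ≤ T M₀ z₀ c₀ → ChartBy 𝓘 τ t z c z₀ c₀ e →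
      FineChart δ z c z₀ c₀ e → InForcePolytope κ σ H F X z c z₀ c₀ e →
        ∀ a ∈ ball (63 / 10) z c, IsReach z c a → ‖siteForce 7 z a - linForce H F z c z₀ c₀ e a‖ ≤ ρ + X M₀ z₀ c₀ (e a)

/-- The triangle step shared by the two reductions. [formal bookkeeping] -/
theorem norm_lin_le_of_cap_of_rem {f l : E3} {σ ρ x : ℝ} (h₁ : ‖f‖ ≤ σ) (h₂ : ‖f - l‖ ≤ ρ + x) : ‖l‖ ≤ σ + ρ + x := by
  have h : ‖l‖ ≤ ‖f‖ + ‖f - l‖ := by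
    calc ‖l‖ = ‖f - (f - l)‖ := by rw [sub_sub_cancel]
      _ ≤ ‖f‖ + ‖f - l‖ := norm_sub_le _ _
  linarith

/-- ★ (FC σ) ∧ (TFR κσ) ⟹ (ENC κ): the A-PRIORI enclosure. [folklore] -/
theorem slavingEnclosure_of_forceCap {𝓘 : ChartFam} {τ δ : ℝ} {T : LawTab} {κ σ : ℝ} {H : HessTab} {F : ForceTab} {X : SlackTab} (hF : ForceCapLaw σ)
    (hT : ForceTaylorBound 𝓘 τ δ T (κ * σ) H F X) : SlavingEnclosure 𝓘 τ δ T κ σ H F X := by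
  intro M z c M₀ z₀ c₀ e t hz hcl hm ht htT hch hf a ha hr
  have h := norm_lin_le_of_cap_of_rem (hF M z c hz a hr) (hT M z c M₀ z₀ c₀ e t hz hcl hm ht htT hch hf a ha hr)
  linarith

/-- ★ (FC σ) ∧ (TFR-in κ (κ'σ)) ⟹ (STEP κ κ'): one CONTRACTION step of the chain. [folklore] -/
theorem remainderStep_of_forceCap {𝓘 : ChartFam} {τ δ : ℝ} {T : LawTab} {κ κ' σ : ℝ} {H : HessTab} {F : ForceTab} {X : SlackTab} (hF : ForceCapLaw σ)
    (hT : ForceTaylorBoundIn 𝓘 τ δ T κ σ (κ' * σ) H F X) : RemainderStep 𝓘 τ δ T σ H F X κ κ' := by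
  intro M z c M₀ z₀ c₀ e t hz hcl hm ht htT hch hf hP a ha hr
  have h := norm_lin_le_of_cap_of_rem (hF M z c hz a hr) (hT M z c M₀ z₀ c₀ e t hz hcl hm ht htT hch hf hP a ha hr)
  linarith

/-- (TFR) ⟹ (TFR-in) (forgetting the polytope information). [formal bookkeeping] -/
theorem forceTaylorBoundIn_of_forceTaylorBound {𝓘 : ChartFam} {τ δ : ℝ} {T : LawTab} {κ σ ρ : ℝ} {H : HessTab} {F : ForceTab} {X : SlackTab}
    (h : ForceTaylorBound 𝓘 τ δ T ρ H F X) : ForceTaylorBoundIn 𝓘 τ δ T κ σ ρ H F X :=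
  fun M z c M₀ z₀ c₀ e t hz hcl hm ht htT hch hf _ => h M z c M₀ z₀ c₀ e t hz hcl hm ht htT hch hf

/-! ## §4. RECORDS -/

/-- ★★★★ **THE ENCLOSURE RECORD `coreOff_record_g57e ηP κ`** — [CORE-FAR] `CoreOffTubeFloor (63/10) (63/10) (24/5) (1/100) 0` from the g56 designate with (LINᴾ⁻ Ψ)
DECOMPOSED: (BASᴾ-fix) [ANALYTIC · IDEA-NEEDED, unsplit] · (MEMᴾ-fix μ) · (ENCᴾ κ) [ANALYTIC · UNDECIDED] · (NEEDCERTᴾ κ Ψ) [INSTRUMENTABLE] · (F1-law on `𝓘₀ꟴ(ηP)`)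
[see `envelopeQ_of_enclosure`] · (F2-bent₀) · (F3ᴰ (Ψ + ϱ₀ + μ)) · [BRIDGE] · [SOFT-FAR]; (T2⁻) a theorem.  Any tables `H, F, X` (designated: `hessBlk0`, `force0`,
the census's exterior column). [folklore] -/
theorem coreOff_record_g57e (ηP κ : ℝ) {H : HessTab} {F : ForceTab} {X : SlackTab} {Ψ : ModTab} {μ : LawTab} (hBP : BasinFix (ClassP ηP) tau0 delta0 T0)
    (hMP : MembershipFix (ClassP ηP) tau0 delta0 T0 μ) (hEP : SlavingEnclosure (ClassP ηP) tau0 delta0 T0 κ sigmaOne H F X)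
    (hNP : NeedCert (ClassP ηP) tau0 delta0 T0 κ sigmaOne H F X G0 wMinus Ψ) (hQ : FamilyEnvelopeLaw (ClassQ ηP) tau0 T0 (withColumns Ψ μ))
    (hR : FamilyRoomBent0) (hC : FamilyCertD (withColumns Ψ μ)) (hBand : BandFarFloor (63 / 10) (63 / 10) (24 / 5) (1 / 100) (3 / 50) (1 / 10) 0)
    (hS : SoftFarFloor (63 / 10) (63 / 10) (24 / 5) (1 / 100) (1 / 10) 0) : CoreOffTubeFloor (63 / 10) (63 / 10) (24 / 5) (1 / 100) 0 :=
  coreOff_record_g56_splitFix ηP hBP hMP (slavedLaw_of_enclosure hEP hNP) hQ hR hC hBand hS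

/-- ★★★★ **THE CHAIN RECORD `coreOff_record_g57c ηP k n`** — as `coreOff_record_g57e` at `κ = k n`, with (ENCᴾ (k n)) REPLACED by (FC σ₁) [ATTACKABLE · KNOWN-MATH] ·
(TFRᴾ ((k 0)·σ₁)) [KNOWN-MATH · ATTACKABLE, crude Taylor] · the `n` steps (TFR-inᴾ (k i) ((k (i+1))·σ₁)) [ANALYTIC + INSTRUMENTABLE (structured remainder sup
bounds); UNDECIDED — the chain's closing is the cheapest falsifier of the whole line]. [folklore] -/
theorem coreOff_record_g57c (ηP : ℝ) (k : ℕ → ℝ) (n : ℕ) {H : HessTab} {F : ForceTab} {X : SlackTab} {Ψ : ModTab} {μ : LawTab}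
    (hBP : BasinFix (ClassP ηP) tau0 delta0 T0) (hMP : MembershipFix (ClassP ηP) tau0 delta0 T0 μ) (hFC : ForceCapOne)
    (hT0 : ForceTaylorBound (ClassP ηP) tau0 delta0 T0 (k 0 * sigmaOne) H F X)
    (hSt : ∀ i : ℕ, i < n → ForceTaylorBoundIn (ClassP ηP) tau0 delta0 T0 (k i) sigmaOne (k (i + 1) * sigmaOne) H F X)
    (hNP : NeedCert (ClassP ηP) tau0 delta0 T0 (k n) sigmaOne H F X G0 wMinus Ψ) (hQ : FamilyEnvelopeLaw (ClassQ ηP) tau0 T0 (withColumns Ψ μ))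
    (hR : FamilyRoomBent0) (hC : FamilyCertD (withColumns Ψ μ)) (hBand : BandFarFloor (63 / 10) (63 / 10) (24 / 5) (1 / 100) (3 / 50) (1 / 10) 0)
    (hS : SoftFarFloor (63 / 10) (63 / 10) (24 / 5) (1 / 100) (1 / 10) 0) : CoreOffTubeFloor (63 / 10) (63 / 10) (24 / 5) (1 / 100) 0 :=
  coreOff_record_g57e ηP (k n) hBP hMP
    (slavingEnclosure_of_chain k n (slavingEnclosure_of_forceCap hFC hT0) fun i hi => remainderStep_of_forceCap hFC (hSt i hi)) hNP hQ hR hC hBand hS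

/-- ★★★ The WHOLE-FAMILY enclosure record (no class split): `coreOff_record_g56f` with (LINᴰ⁻ Ψ) ⟸ (ENCᴰ κ) ∧ (NEEDCERTᴰ κ Ψ). [folklore] -/
theorem coreOff_record_g57u (κ : ℝ) {H : HessTab} {F : ForceTab} {X : SlackTab} {Ψ : ModTab} {μ : LawTab} (hB : BasinDFix) (hM : MembershipDFix μ)
    (hE : SlavingEnclosure ChartFamilyD tau0 delta0 T0 κ sigmaOne H F X) (hN : NeedCert ChartFamilyD tau0 delta0 T0 κ sigmaOne H F X G0 wMinus Ψ)
    (hR : FamilyRoomBent0) (hC : FamilyCertD (withColumns Ψ μ)) (hBand : BandFarFloor (63 / 10) (63 / 10) (24 / 5) (1 / 100) (3 / 50) (1 / 10) 0)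
    (hS : SoftFarFloor (63 / 10) (63 / 10) (24 / 5) (1 / 100) (1 / 10) 0) : CoreOffTubeFloor (63 / 10) (63 / 10) (24 / 5) (1 / 100) 0 :=
  coreOff_record_g56f hB hM (slavedLaw_of_enclosure hE hN) hR hC hBand hS

/-- ★★ THE ROUGH CLASS IN THE SAME ARCHITECTURE (critic row 1051 (B): ONE idea node for both classes): (F1-law on `𝓘₀ꟴ(ηP)` with `Ψ_Q + ϱ₀ + μ_Q`) ⟸ (BASꟴ-fix) ·
(MEMꟴ-fix μ_Q) · (ENCꟴ κ_Q) · (NEEDCERTꟴ κ_Q Ψ_Q); (T2⁻) is a theorem on `𝓘₀ꟴ` too.  On the rough class even the LINEAR certificate is red at `Ψ` of record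
(`M_D(T2⁻)` HM62 −13 %, HE60 +8 %), so here the open number is (NEEDCERTꟴ κ_Q Ψ_Q) for a NEW `Ψ_Q`, not only (ENCꟴ). [folklore] -/
theorem envelopeQ_of_enclosure (ηP κ : ℝ) {H : HessTab} {F : ForceTab} {X : SlackTab} {Ψ : ModTab} {μ : LawTab} (hB : BasinFix (ClassQ ηP) tau0 delta0 T0)
    (hM : MembershipFix (ClassQ ηP) tau0 delta0 T0 μ) (hE : SlavingEnclosure (ClassQ ηP) tau0 delta0 T0 κ sigmaOne H F X)
    (hN : NeedCert (ClassQ ηP) tau0 delta0 T0 κ sigmaOne H F X G0 wMinus Ψ) : FamilyEnvelopeLaw (ClassQ ηP) tau0 T0 (withColumns Ψ μ) :=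
  familyEnvelopeLaw_of_taylor_fix hB (taylorTwoMinus_classQ ηP) hM (slavedLaw_of_enclosure hE hN)

/-- ★★★ The TWO-CLASS enclosure record with per-class tables and per-class inflations: everything typed by ONE architecture. [folklore] -/
theorem coreOff_record_g57pq (ηP κP κQ : ℝ) {H : HessTab} {F : ForceTab} {X : SlackTab} {ΨP ΨQ : ModTab} {μP μQ : LawTab}
    (hBP : BasinFix (ClassP ηP) tau0 delta0 T0) (hMP : MembershipFix (ClassP ηP) tau0 delta0 T0 μP)
    (hEP : SlavingEnclosure (ClassP ηP) tau0 delta0 T0 κP sigmaOne H F X) (hNP : NeedCert (ClassP ηP) tau0 delta0 T0 κP sigmaOne H F X G0 wMinus ΨP)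
    (hBQ : BasinFix (ClassQ ηP) tau0 delta0 T0) (hMQ : MembershipFix (ClassQ ηP) tau0 delta0 T0 μQ)
    (hEQ : SlavingEnclosure (ClassQ ηP) tau0 delta0 T0 κQ sigmaOne H F X) (hNQ : NeedCert (ClassQ ηP) tau0 delta0 T0 κQ sigmaOne H F X G0 wMinus ΨQ)
    (hR : FamilyRoomBent0) (hCP : FamilyCert (ClassP ηP) 0 (withColumns ΨP μP) T0) (hCQ : FamilyCert (ClassQ ηP) 0 (withColumns ΨQ μQ) T0)
    (hBand : BandFarFloor (63 / 10) (63 / 10) (24 / 5) (1 / 100) (3 / 50) (1 / 10) 0) (hS : SoftFarFloor (63 / 10) (63 / 10) (24 / 5) (1 / 100) (1 / 10) 0) :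
    CoreOffTubeFloor (63 / 10) (63 / 10) (24 / 5) (1 / 100) 0 :=
  coreOff_record_g57s ηP hBP hMP (slavedLaw_of_enclosure hEP hNP) (envelopeQ_of_enclosure ηP κQ hBQ hMQ hEQ hNQ) hR hCP hCQ hBand hS

/-! ## §5. The class threshold (critic row 1050 (iii)) -/

/-- ★ Pin: the recommended class threshold `ηP₁ := 47/800 = 0.05875`, MIDWAY between the census levels of HE58 (`η_mm = 0.0578`, class P) and HE60 (`0.0597`, class Q);
membership of an instance in `ClassP ηP` is DECIDED by `η_mm(centre) < ηP` (the strict `η < ηmax` of `GoodAtScale`): P = {FZ00, HZ00, HE52, HE55, HE58},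
Q = {HE60, HM62}; a host «HE59» (`η_mm ≈ 0.0588`) would be Q.  The records admit any `ηP`; `29/500` (g56) puts HE58 in P with margin `2·10⁻⁴` only. -/
noncomputable def etaP1 : ℝ := 47 / 800

/-- `0.0578 < ηP₁ < 0.0597` with equal margins `9.5·10⁻⁴`, and `ηP₁ ≤ η₀₀ = 1/16`. [formal bookkeeping] -/
theorem etaP1_window : (578 / 10000 : ℝ) < etaP1 ∧ etaP1 < 597 / 10000 ∧ etaP1 ≤ eta00 := by
  rw [etaP1, eta00]; norm_num

end Summit.AtomisticToContinuum.Crystallization.Theorems.FrustratedLawDichotomyStrainedPatchQuantSlaving
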